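import Literature.NumberTheory.EllipticCurves.Curve6137TwoIsogenyDescent
import Literature.NumberTheory.EllipticCurves.IsogenyTwoTorsionProofs
import Literature.NumberTheory.EllipticCurves.IsogenyVariableChangeProofs
import Literature.NumberTheory.EllipticCurves.SelmerCorankIsogenyProofs
import Literature.NumberTheory.EllipticCurves.IwasawaLeadingTermProofs
import Literature.NumberTheory.EllipticCurves.BSDInvariantsProofs
import Literature.NumberTheory.EllipticCurves.ShaPTorsionQuadraticSplitting
import HarnessLib

/-!
# The `2`-isogeny descent on Cremona's `9312d1` (rank `2`, a curve of the rank-2 `p`-adic atlas): Selmer sets by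
# divisibility and the real place alone; `rank ≤ 2`; door at `2` given `rank ≥ 2`

Topic `Literature/NumberTheory/EllipticCurves`, family `bsd`. Theorems only. Companion of `Curve1088j1TwoIsogenyDescent`
(same method, same shape of statements) for another row of the tree's rank-2 `p`-adic atlas
(`Rank2ObservatoryPadicAtlasR2A*`, cells at `p = 5, 7, 13`): Cremona's `9312d1`,

  `E = [0, -1, 0, -34, 88]`, rational `2`-torsion point `(4, 0)`, `X = ⟨1, 4, 0, 0⟩ • E = [0, 11, 0, 6, 0]`,
  `X' = X.twoIsogenyCodomain = [0, -22, 0, 97, 0]`.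

The descent (Silverman, *AEC*, Prop. X.4.9, Example X.4.10) in the tree's currency `twoIsogenySelmerGroup`:
`S(11, 6) ⊆ {±1, ±2, ±3, ±6}` and `S(-22, 97) ⊆ {1, 97}` — the only excluded classes are NEGATIVE squarefree
divisors, which die over `ℝ` (`not_isSoluble_real_twoIsogenyQuartic_of_neg`); no `p`-adic certificate is needed. Hence
`dim₂ S + dim₂ S' ≤ 4`, `rank X(ℚ) ≤ 2`, and GIVEN `2 ≤ rank` (the observatory's kernel certificate, Summits-side) the
descent is SHARP: `rank = 2`, `Ш(E/ℚ)[2] = 0`, `t_2(E) = 0`, `#Ш(E/ℚ)[2] = 1` (`door_at_two_of_two_le_rank`) — the descent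
half of a `{2, p ordinary}` cross-prime row of route ShaPrimaryTransfer.

## References

* J. H. Silverman, *The Arithmetic of Elliptic Curves*, 2nd ed. (2009), Prop. X.4.9, Example X.4.10, Thm. X.4.2,
  III.3.1(b). [SilvermanAEC2009]
* J. E. Cremona, *Algorithms for Modular Elliptic Curves*, 2nd ed. (1997), Table 1 (curve `9312d1`). [Cremona1997Algorithms]
-/

noncomputable section

open scoped Classical
open scoped AddSubgroup

namespace Literature.NumberTheory.EllipticCurves

namespace Curve9312d1

open _root_.WeierstrassCurve _root_.WeierstrassCurve.Affine

/-! ## `9312d1`: `E = [0, -1, 0, -34, 88]`, `X = ⟨1, 4, 0, 0⟩ • E = [0, 11, 0, 6, 0]`, `X' = [0, -22, 0, 97, 0]` -/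

/-- `b(a² − 4b) ≠ 0` for `X = E_{11,6}`. [cite: SilvermanAEC2009, Prop. X.4.9] -/
theorem habX : (6 : ℤ) * ((11 : ℤ) ^ 2 - 4 * (6)) ≠ 0 := by norm_num

/-- The tree's literal `E_{11,6}` is `X`. [cite: SilvermanAEC2009, Prop. X.4.9] -/
theorem lit_X : (⟨0, ((11 : ℤ) : ℚ), 0, ((6 : ℤ) : ℚ), 0⟩ : WeierstrassCurve ℚ) = ⟨0, 11, 0, 6, 0⟩ := by
  ext <;> push_cast <;> ring

/-- The half-model literal for `(a,b) = (11, 6)`. [cite: SilvermanAEC2009, Prop. X.4.9] -/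
private theorem lit_V₀ :
    (⟨0, -((11 : ℤ) : ℚ) / 2, 0, (((11 : ℤ) : ℚ) ^ 2 - 4 * (6 : ℤ)) / 16, 0⟩ : WeierstrassCurve ℚ) =
      ⟨0, -11 / 2, 0, 97 / 16, 0⟩ := by
  ext <;> push_cast <;> ring

/-- `X = [0, 11, 0, 6, 0]` is an elliptic curve. [cite: SilvermanAEC2009, Prop. X.4.9] -/
theorem isElliptic_X : (⟨0, 11, 0, 6, 0⟩ : WeierstrassCurve ℚ).IsElliptic := by
  rw [← lit_X]; exact isElliptic_mk_of_ne_zero (F := ℚ) habX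

/-- The half-model of `X'` is an elliptic curve. [cite: SilvermanAEC2009, Prop. X.4.9] -/
private theorem isElliptic_V₀ : (⟨0, -11 / 2, 0, 97 / 16, 0⟩ : WeierstrassCurve ℚ).IsElliptic := by
  rw [← lit_V₀]; exact isElliptic_halfModel habX

/-- `E = [0, -1, 0, -34, 88]` (Cremona `9312d1`) is an elliptic curve. [cite: Cremona1997Algorithms, Table 1 (curve 9312d1)] -/
theorem isElliptic_E : (⟨0, -1, 0, -34, 88⟩ : WeierstrassCurve ℚ).IsElliptic :=
  ⟨by norm_num [WeierstrassCurve.Δ, WeierstrassCurve.b₂, WeierstrassCurve.b₄, WeierstrassCurve.b₆, WeierstrassCurve.b₈]⟩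

/-- **`X = ⟨1, 4, 0, 0⟩ • E`**: moving the rational `2`-torsion point `(4, 0)` of `9312d1` to the origin. [cite: SilvermanAEC2009, III.3.1(b)] -/
theorem smul_E_eq_X :
    (⟨1, 4, 0, 0⟩ : VariableChange ℚ) • (⟨0, -1, 0, -34, 88⟩ : WeierstrassCurve ℚ) = ⟨0, 11, 0, 6, 0⟩ := by
  ext
  · simp [WeierstrassCurve.variableChange_a₁]
  · rw [WeierstrassCurve.variableChange_a₂]; norm_num
  · simp [WeierstrassCurve.variableChange_a₃]
  · rw [WeierstrassCurve.variableChange_a₄]; norm_num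
  · rw [WeierstrassCurve.variableChange_a₆]; norm_num

/-- `E ~ X` over `ℚ` (isomorphic models). [cite: SilvermanAEC2009, III.3.1(b)] -/
theorem isIsogenous_E_X :
    IsIsogenous (⟨0, -1, 0, -34, 88⟩ : WeierstrassCurve ℚ) (⟨0, 11, 0, 6, 0⟩ : WeierstrassCurve ℚ) :=
  isIsogenous_of_smul_eq smul_E_eq_X

/-- A squarefree integer dividing `6` is `±` a divisor of `6`. [cite: SilvermanAEC2009, Prop. X.4.9] -/
private theorem mem_of_dvd_X {d : ℤ} (hsq : Squarefree d) (hd : d ∣ (6 : ℤ)) :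
    d ∈ ({1, -1, 2, -2, 3, -3, 6, -6} : Finset ℤ) := by
  have hrad : d ∣ 6 := by
    have h5 : d ∣ (6 : ℤ) ^ 1 := dvd_trans hd ⟨1, by norm_num⟩
    exact (hsq.dvd_pow_iff_dvd (by norm_num)).mp h5
  have h1 : d.natAbs ∣ 6 := by
    have := Int.natAbs_dvd_natAbs.mpr hrad
    simpa using this
  have h2 : d.natAbs ∈ Nat.divisors 6 := Nat.mem_divisors.mpr ⟨h1, by norm_num⟩
  rw [show Nat.divisors 6 = {1, 2, 3, 6} by decide] at h2
  simp only [Finset.mem_insert, Finset.mem_singleton] at h2 ⊢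
  rcases Int.natAbs_eq d with h | h <;> rw [h] <;> rcases h2 with h2 | h2 | h2 | h2 <;> simp [h2]

/-- **`S(11, 6) ⊆ {1, -1, 2, -2, 3, -3, 6, -6}`** (all squarefree divisors). [cite: SilvermanAEC2009, Prop. X.4.9 and Example X.4.10] -/
theorem twoIsogenySelmerGroup_X_subset :
    twoIsogenySelmerGroup (11) (6) ⊆ ({1, -1, 2, -2, 3, -3, 6, -6} : Finset ℤ) := by
  intro d hd
  obtain ⟨hsq, hdvd, -⟩ := (mem_twoIsogenySelmerGroup_iff (a := 11) (by norm_num : (6 : ℤ) ≠ 0)).mp hd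
  exact mem_of_dvd_X hsq hdvd

/-- A squarefree integer dividing `97` is `±` a divisor of `97`. [cite: SilvermanAEC2009, Prop. X.4.9] -/
private theorem mem_of_dvd_X' {d : ℤ} (hsq : Squarefree d) (hd : d ∣ (97 : ℤ)) :
    d ∈ ({1, -1, 97, -97} : Finset ℤ) := by
  have hrad : d ∣ 97 := by
    have h5 : d ∣ (97 : ℤ) ^ 1 := dvd_trans hd ⟨1, by norm_num⟩
    exact (hsq.dvd_pow_iff_dvd (by norm_num)).mp h5
  have h1 : d.natAbs ∣ 97 := by
    have := Int.natAbs_dvd_natAbs.mpr hrad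
    simpa using this
  have h2 : d.natAbs ∈ Nat.divisors 97 := Nat.mem_divisors.mpr ⟨h1, by norm_num⟩
  rw [show Nat.divisors 97 = {1, 97} by decide] at h2
  simp only [Finset.mem_insert, Finset.mem_singleton] at h2 ⊢
  rcases Int.natAbs_eq d with h | h <;> rw [h] <;> rcases h2 with h2 | h2 <;> simp [h2]

/-- **`S(-22, 97) ⊆ {1, 97}`** (the negative squarefree divisors die over `ℝ`). [cite: SilvermanAEC2009, Prop. X.4.9 and Example X.4.10] -/
theorem twoIsogenySelmerGroup_X'_subset :
    twoIsogenySelmerGroup (-22) (97) ⊆ ({1, 97} : Finset ℤ) := by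
  intro d hd
  obtain ⟨hsq, hdvd, hloc⟩ := (mem_twoIsogenySelmerGroup_iff (a := -22) (by norm_num : (97 : ℤ) ≠ 0)).mp hd
  have hdpos : 0 < d := by
    rcases lt_trichotomy d 0 with hneg | h0 | hpos
    · exfalso
      have hquot : (97 : ℤ) / d < 0 := by
        obtain ⟨k, hk⟩ := hdvd
        rw [hk, Int.mul_ediv_cancel_left _ hneg.ne]
        nlinarith
      exact not_isSoluble_real_twoIsogenyQuartic_of_neg hneg hquot (by norm_num) hloc.1
    · exact absurd h0 hsq.ne_zero
    · exact hpos
  have hmem := mem_of_dvd_X' hsq hdvd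
  simp only [Finset.mem_insert, Finset.mem_singleton] at hmem ⊢
  rcases hmem with rfl | rfl | rfl | rfl
  all_goals first | (norm_num at hdpos; done) | simp

/-- `2^k ≤ 2^n` forces `k ≤ n`. [cite: SilvermanAEC2009, Prop. X.4.9] -/
private theorem le_of_two_pow_le {k n : ℕ} (h : 2 ^ k ≤ 2 ^ n) : k ≤ n :=
  (Nat.pow_le_pow_iff_right (by norm_num)).mp h

/-- **`dim₂ S(11, 6) ≤ 3` and `dim₂ S(-22, 97) ≤ 1`.** [cite: SilvermanAEC2009, Prop. X.4.9] -/
theorem twoIsogenySelmerRank_X_add_le :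
    twoIsogenySelmerRank (11) (6) ≤ 3 ∧ twoIsogenySelmerRank' (11) (6) ≤ 1 := by
  constructor
  · apply le_of_two_pow_le
    rw [two_pow_twoIsogenySelmerRank_eq_card habX]
    exact (Finset.card_le_card twoIsogenySelmerGroup_X_subset).trans (by decide)
  · apply le_of_two_pow_le
    rw [two_pow_twoIsogenySelmerRank'_eq_card habX, twoIsogenySelmerGroup'_eq,
      show (-2 * (11) : ℤ) = -22 by norm_num, show ((11 : ℤ) ^ 2 - 4 * (6) : ℤ) = 97 by norm_num]
    exact (Finset.card_le_card twoIsogenySelmerGroup_X'_subset).trans (by decide)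

/-- **`rank X(ℚ) ≤ 2`**: `rank + 2 ≤ dim₂ S + dim₂ S' ≤ 4`. [cite: SilvermanAEC2009, Prop. X.4.7 with Thm. X.4.2(a)] -/
theorem mordellWeilRank_X_le_two : (⟨0, 11, 0, 6, 0⟩ : WeierstrassCurve ℚ).mordellWeilRank ≤ 2 := by
  have h := twoIsogeny_mordellWeilRank_add_two_le_holds (11) (6) habX
  rw [lit_X] at h
  have h2 := twoIsogenySelmerRank_X_add_le
  omega

/-- **The descent is sharp once `rank ≥ 2`**: `Ш(X/ℚ)[2] = 0`. [cite: SilvermanAEC2009, Prop. X.4.7 with Thm. X.4.2(a)] -/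
theorem forall_mem_sha_X_two_smul_eq_zero (h2 : 2 ≤ (⟨0, 11, 0, 6, 0⟩ : WeierstrassCurve ℚ).mordellWeilRank) :
    ∀ c ∈ (⟨0, 11, 0, 6, 0⟩ : WeierstrassCurve ℚ).sha, 2 • c = 0 → c = 0 := by
  haveI : (⟨0, -((11 : ℤ) : ℚ) / 2, 0, (((11 : ℤ) : ℚ) ^ 2 - 4 * (6 : ℤ)) / 16, 0⟩ :
      WeierstrassCurve ℚ).IsElliptic := by rw [lit_V₀]; exact isElliptic_V₀
  haveI : (⟨0, ((11 : ℤ) : ℚ), 0, ((6 : ℤ) : ℚ), 0⟩ : WeierstrassCurve ℚ).IsElliptic := by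
    rw [lit_X]; exact isElliptic_X
  have hle : twoIsogenySelmerRank (11) (6) + twoIsogenySelmerRank' (11) (6) ≤
      (⟨0, ((11 : ℤ) : ℚ), 0, ((6 : ℤ) : ℚ), 0⟩ : WeierstrassCurve ℚ).mordellWeilRank + 2 := by
    rw [lit_X]
    have h := twoIsogenySelmerRank_X_add_le
    omega
  have h := forall_mem_sha_two_smul_eq_zero_of_selmerRank_add_le (a := 11) (b := 6) habX hle
  rwa [lit_X] at h

/-- **On Cremona's model `9312d1 = [0, -1, 0, -34, 88]`**: if `2 ≤ rank E(ℚ)` then `rank E(ℚ) = 2`, `t_2(E) = 0` and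
`#Ш(E/ℚ)[2] = 1` — the door at `2` by descent. [cite: SilvermanAEC2009, Prop. X.4.7, Thm. X.4.2(a) and III.3.1(b)] [cite: Cremona1997Algorithms, Table 1 (curve 9312d1)] -/
theorem door_at_two_of_two_le_rank (h2 : 2 ≤ (⟨0, -1, 0, -34, 88⟩ : WeierstrassCurve ℚ).mordellWeilRank) :
    (⟨0, -1, 0, -34, 88⟩ : WeierstrassCurve ℚ).mordellWeilRank = 2 ∧
      (⟨0, -1, 0, -34, 88⟩ : WeierstrassCurve ℚ).shaCorank 2 = 0 ∧
      Nat.card ((⟨0, -1, 0, -34, 88⟩ : WeierstrassCurve ℚ).sha[((2 : ℕ) : ℤ)]) = 1 := by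
  haveI := isElliptic_X
  haveI := isElliptic_E
  haveI : Fact (Nat.Prime 2) := ⟨Nat.prime_two⟩
  have hrk : (⟨0, 11, 0, 6, 0⟩ : WeierstrassCurve ℚ).mordellWeilRank =
      (⟨0, -1, 0, -34, 88⟩ : WeierstrassCurve ℚ).mordellWeilRank := by
    have h := mordellWeilRank_variableChange_holds (⟨0, -1, 0, -34, 88⟩ : WeierstrassCurve ℚ)
      (⟨1, 4, 0, 0⟩ : VariableChange ℚ)
    rwa [mordellWeilRank_variableChange, smul_E_eq_X] at h
  have h2X : 2 ≤ (⟨0, 11, 0, 6, 0⟩ : WeierstrassCurve ℚ).mordellWeilRank := by rw [hrk]; exact h2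
  refine ⟨by rw [← hrk]; exact le_antisymm mordellWeilRank_X_le_two h2X,
    by rw [isIsogenous_E_X.shaCorank_eq 2]; exact shaCorank_eq_zero_of_forall _ 2 (forall_mem_sha_X_two_smul_eq_zero h2X), ?_⟩
  have hX1 : Nat.card ((⟨0, 11, 0, 6, 0⟩ : WeierstrassCurve ℚ).sha[((2 : ℕ) : ℤ)]) = 1 := by
    have hbot : (⟨0, 11, 0, 6, 0⟩ : WeierstrassCurve ℚ).sha[((2 : ℕ) : ℤ)] = ⊥ := by
      refine (AddSubgroup.eq_bot_iff_forall _).mpr fun x hx ↦ Subtype.ext ?_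
      have hx' : 2 • (x : (⟨0, 11, 0, 6, 0⟩ : WeierstrassCurve ℚ).galH1) = 0 := by
        rw [← AddSubgroupClass.coe_nsmul, AddSubgroup.torsionBy.nsmul_iff.mp hx, ZeroMemClass.coe_zero]
      exact forall_mem_sha_X_two_smul_eq_zero h2X _ x.2 hx'
    rw [hbot]; exact AddSubgroup.card_bot
  rw [← natCard_sha_torsionBy_variableChange (⟨0, -1, 0, -34, 88⟩ : WeierstrassCurve ℚ)
    (⟨1, 4, 0, 0⟩ : VariableChange ℚ) 2, smul_E_eq_X]
  exact hX1

end Curve9312d1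

end Literature.NumberTheory.EllipticCurves

end
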